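import Summits.QuantumFields.YangMills.Theorems.UnitScaleTiltProp7QTwCentralSector
import Summits.QuantumFields.YangMills.Theorems.UnitScaleTiltProp7QTwCentralScalarField
import Summits.QuantumFields.YangMills.Theorems.UnitScaleTiltProp7QTwFlatExplicitT3
import Summits.QuantumFields.YangMills.Theorems.UnitScaleTiltProp7SymAvgRelDiffT3
import Summits.QuantumFields.YangMills.Theorems.UnitScaleTiltProp7SymAvgTwFrameDiff
import HarnessLib

/-!
# Route `UnitScaleTilt`, crux K1 child «MinimiserStabilityRegPr» (stmt-QuantumFields-19200), stub `stub_existenceMinimalOrbit` (EX), lane II (B4★)∕(QB) «⊕ central» summand —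
# **THE COMB CHART ON THE CENTRE, DISCHARGED ON PRINT'S REGULAR SPACE `𝔘_k(ε₀)`**: at every printed-regular background `U₀` (`RegPr F n K ε₀ U₀`, window `10⁷L³ε₀ ≤ 1`) print's comb
# averaging operator `Q(U₀) = QTw U₀` of ✓`Prop7SymAvgTwDefs` takes ITS FLAT VALUE on the scalar sector: **`QTw U₀ (c·1) = QTw 1 (c·1)`** for every complex bond field `c` — the five displayed
# clauses of ✓`Prop7QTwCentralSector.QTw_smulI_one_eq_QTw_one` SUPPLIED BY NAME: `hd` (✓`hasFDerivAt_logChartTw` ∘ ✓`hasFDerivAt_rel_of_regPr` ∘ ✓`hasFDerivAt_frameTw_of_regPr`), `hd₁`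
# (✓`differentiableAt_logChartTw_one`), `hUT` (✓`loopHolU_emlIterU_bgUnits_le_eighth_of_regPr`), `hUZ` (lit [Balaban1985Averaging] Prop. 2 `B7Prop2Explicit.avgIter_mem`∕`prop2_explicit_lt_two` +
# `norm_Wcx_sub_one_le` on the based pullback `U₀♯`, (1.139) by ✓`inAk_pull_of_regPr`∕`pdev_pull_lt`), and the scalar `∃ δ` clause for the UNITARY scalar field `e^{itr}`, `r` real, `t` real
# small (torus loops: ✓`scalarTower_small_T3` + gauge invariance of the abelian loop variables; `ℤ³` loops: Prop. 2 at `𝔸 = ℂ`; flat frame quotients: lit `B8Prop7AdmittedFamily.norm_vcov_sub_one_le`∕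
# `norm_tHol_tildIter_sub_one_le` at `𝔸 = ℂ`, `U₀ = 1`, every window a FIXED number `ε_s := (10⁷L³)⁻¹` via ✓`windows_of_ten7`∕`tower_windows_of_ten7`).

Cell `ym3-torus`, width seat `ym3-torus-px10` (gen 5).  `--supports stmt-QuantumFields-19200 --as helper`; THEOREMS ONLY (0 `def`, 0 `sorry`); count-neutral; nothing here claims the
stub, the crux, d = 4 or the mass gap — YM₃ on T³ is a ladder rung (R3), not the Clay problem.

WHY (px19 g6 LOCATE v2 §3 exit (c-i); px10 g5 LOCATE).  With this file lane II's (ENG)∕(QB) central summand is the FLAT comb Poincaré (✓`Prop7QTwFlatExplicitT3.QTw_one_apply`∕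
`QTw_one_eq_tube_sub_coarseGrad` at `Y := τ•1`): the located letter gap «the tree has the central calculus for the SYMMETRIC chart only» is closed for the comb chart.

WHAT IS PROVED (`k := K − n`, `x₀ := basePt F n K`, `U₀♯ := pull (bgUnits F K U₀) x₀`):
* §1 (T³ background) ★`loopsZ_bgUnits_le_eighth_of_regPr` (= `hUZ`: ✓`Prop7QTwCentralScalarField.loops_le_eighth_of_pdev` on the based pullback, (1.139) by ✓`pdev_pull_lt ∘ inAk_pull_of_regPr`),
  `differentiableAt_logChartTw_of_regPr` (= `hd`).
* §2 ★★★`QTw_smul_one_eq_QTw_one_of_regPr (hε₀) (hε : 10⁷L³ε₀ ≤ 1) (U₀) (hreg) (c) : QTw F n K h U₀ (fun b ↦ c b • 1) = QTw F n K h 1 (fun b ↦ c b • 1)` (+ applied form), with `hd₁` ✓`differentiableAt_logChartTw_one`,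
  `hUT` ✓`loopHolU_emlIterU_bgUnits_le_eighth_of_regPr`, `hδ` ✓`Prop7QTwCentralScalarField.scalarClauses_small`.
HONEST SCOPE.  Assembly by name over landed theorems; the only analytic inputs are lit [Balaban1985Averaging] Props. 2∕7-admitted (kernel theorems of the tree) and the cited T³ readings of
`RegPr`; nothing of [Balaban1985BackgroundPropagators] is asserted; (ENG)∕(QB)∕(REC)∕`hN06`∕the crux are NOT advanced by this file alone.

References: T. Bałaban, CMP **98** (1985) 17–51 [Balaban1985Averaging] (Prop. 2 (52)–(54) p.26, p.25, (85)–(92) p.31, (97)+(99) p.32, (159)–(163) p.42); CMP **99** (1985) 75–102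
[Balaban1985RegularSpaces] ((1.139) p.100, Prop. 7 p.100); CMP **99** (1985) 389–434 [Balaban1985BackgroundPropagators] ((3.13)–(3.15) p.393); CMP **95** (1984) 17–40 [Balaban1984PropagatorsI]
((1.18) p.20); CMP **102** (1985) 277–309 [Balaban1985Variational] ((2) p.278, (44) p.285); CMP **109** (1987) 249–301 [Balaban1987RG1] ((0.4), (0.11) p.253).
-/

set_option autoImplicit false

noncomputable section

open scoped Matrix.Norms.L2Operator Topology

namespace Summit.QuantumFields.YangMills.Theorems.Prop7QTwCentralSectorRegPr

open NormedSpace Filter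
open Literature.MathematicalPhysics.QuantumFieldTheory.Balaban1983to89
open T4Continuum BlockAveraging ExpMeanLog MatrixLog
open T3ContinuumYM3Torus
open T3LevelShift (siteShift bondShift)
open T3PrintedRegularOrbits (sites_eq)
open T3PrintedRegularMinimiser (RegPr)
open T3SectALandauChart (bgUnits bgUnits_one)
open B7Prop1Explicit renaming Site → LSite
open B7Prop1Explicit (expUnit boxVec Wcx)
open B7Prop2Explicit (avgIter pdev)
open B7Prop2SpecialUnitary (specialUnitaryUnits specialUnitaryUnits_le_U1)
open B7AvgClosedSpecialUnitarySharp (avgClosed_specialUnitary_of_le_twentyone)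
open B10Eq27TorusAxialLog (holT pull pull_apply transl gaugeActT)
open Summit.QuantumFields.YangMills.Theorems.Prop7SPrint (basePt)
open Summit.QuantumFields.YangMills.Theorems.Prop8Chart (loopHolU emlIterU)
open Summit.QuantumFields.YangMills.Theorems.Prop7AxialReprPrint (pull_toUField_mem inAk_pull_of_regPr pdev_pull_lt)
open Summit.QuantumFields.YangMills.Theorems.Prop7SymAvgGLSmallOfRegPr (bgUnits_eq)
open Summit.QuantumFields.YangMills.Theorems.Prop7SymAvgTw (logChartTw QTw frameTw)
open Summit.QuantumFields.YangMills.Theorems.Prop7SymAvgTwSym (loopHolU_emlIterU_bgUnits_le_eighth_of_regPr)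
open Summit.QuantumFields.YangMills.Theorems.Prop7SymAvgTwBridge (hasFDerivAt_logChartTw)
open Summit.QuantumFields.YangMills.Theorems.Prop7SymAvgRelDiffT3 (hasFDerivAt_rel_of_regPr)
open Summit.QuantumFields.YangMills.Theorems.Prop7SymAvgTwFrameDiff (hasFDerivAt_frameTw_of_regPr)
open Summit.QuantumFields.YangMills.Theorems.Prop7QTwFlatExplicit (differentiableAt_logChartTw_one)
open Summit.QuantumFields.YangMills.Theorems.Prop7FrameResponseCombSU2 (windows_of_ten7 tower_windows_of_ten7)
open Summit.QuantumFields.YangMills.Theorems.Prop7QTwCentralSector (QTw_smulI_one_eq_QTw_one QTw_smul_one_eq_QTw_one_of_imaginary)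

open Summit.QuantumFields.YangMills.Theorems.Prop7QTwCentralScalarField (loops_le_eighth_of_pdev window_loops scalarClauses_small)

/-! ## §1 The background side at a printed-regular `U₀`: `hUZ` and `hd` -/

section Background

variable (F : T3Family) {n K : ℕ} (h : n ≤ K)

/-- ★ **`hUZ` AT `U₀ ∈ 𝔘_k(ε₀)`**: every loop variable (42) of every `ℤ³` iterate `\overline{U₀♯}ʲ`, `j ≤ K − n`, of the based pullback of a printed-regular background is within `1∕8` of `1`
((1.139) on the pullback ✓`pdev_pull_lt ∘ inAk_pull_of_regPr`, `SU(2)`-valuedness ✓`pull_toUField_mem`, Prop. 2's windows ✓`windows_of_ten7`, §1).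
[cite: Balaban1985RegularSpaces, (1.139) p.100; Balaban1985Averaging, Prop. 2 p.26, p.25] -/
theorem loopsZ_bgUnits_le_eighth_of_regPr {ε₀ : ℝ} (hε₀ : 0 < ε₀) (hε : 10 ^ 7 * (F.L : ℝ) ^ 3 * ε₀ ≤ 1)
    (U₀ : GaugeField (F.P K) 0 (Matrix.specialUnitaryGroup (Fin 2) ℂ)) (hreg : RegPr F n K ε₀ U₀) :
    ∀ j, j < K - n → ∀ (q : LSite (F.P K).d) (κ : Fin (F.P K).d) (r : Fin (F.P K).d → Fin (F.P K).L),
      ‖((Wcx (F.P K).L (avgIter (F.P K).L (pull (bgUnits F K U₀) (basePt F n K)) j) q κ (boxVec (F.P K).L r) : (Matrix (Fin 2) (Fin 2) ℂ)ˣ) : Matrix (Fin 2) (Fin 2) ℂ) - 1‖ ≤ 1 / 8 := by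
  intro j hj q κ r
  have hL2 : 2 ≤ (F.P K).L := (F.P K).hL.2
  have hU₀ : ∀ z κ, pull (bgUnits F K U₀) (basePt F n K) z κ ∈ specialUnitaryUnits (Fin 2) := fun z κ => by
    rw [bgUnits_eq]; exact pull_toUField_mem U₀ _ z κ
  have hG := avgClosed_specialUnitary_of_le_twentyone (N := 2) (by norm_num) (F.P K).d (F.P K).L
  have h52 : pdev (pull (bgUnits F K U₀) (basePt F n K)) < 2 * ε₀ * ((((F.P K).L : ℝ) ^ (K - n))⁻¹) ^ 2 := by
    rw [bgUnits_eq]; exact pdev_pull_lt (P := F.P K) hε₀ (inAk_pull_of_regPr F (n := n) (K := K) hε₀.le hreg) (basePt F n K)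
  obtain ⟨hα3, hα4, -, -, -⟩ := windows_of_ten7 F (K := K) hε₀.le hε
  obtain ⟨hwin, -⟩ := window_loops F (K := K) hε₀.le hε
  exact loops_le_eighth_of_pdev (F.P K).L hL2 hG specialUnitaryUnits_le_U1 _ hU₀ (by positivity : (0 : ℝ) < 2 * ε₀) hα3 (by linarith) hwin (K - n) h52 j hj.le q κ r

/-- **`hd` AT `U₀ ∈ 𝔘_k(ε₀)`**: the twisted comb log-chart is differentiable at `0` (✓`hasFDerivAt_logChartTw` with `hG` ✓`hasFDerivAt_rel_of_regPr`, `hr` ✓`hasFDerivAt_frameTw_of_regPr`; windows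
✓`windows_of_ten7`). [cite: Balaban1985BackgroundPropagators, (3.13)-(3.14) p.393; Balaban1985Averaging, (89) p.31, (97) p.32] -/
theorem differentiableAt_logChartTw_of_regPr {ε₀ : ℝ} (hε₀ : 0 < ε₀) (hε : 10 ^ 7 * (F.L : ℝ) ^ 3 * ε₀ ≤ 1)
    (U₀ : GaugeField (F.P K) 0 (Matrix.specialUnitaryGroup (Fin 2) ℂ)) (hreg : RegPr F n K ε₀ U₀) :
    DifferentiableAt ℂ (logChartTw F n K h U₀) 0 := by
  obtain ⟨hα3, hα4, hexp, -, -⟩ := windows_of_ten7 F (K := K) hε₀.le hε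
  exact (hasFDerivAt_logChartTw F h U₀ (hasFDerivAt_rel_of_regPr F h hε₀ hε U₀ hreg)
    (r := fun y => fderiv ℂ (fun A : PBond (F.P K) 0 → Matrix (Fin 2) (Fin 2) ℂ => ((frameTw F n K h U₀ A y : (Matrix (Fin 2) (Fin 2) ℂ)ˣ) : Matrix (Fin 2) (Fin 2) ℂ)) 0)
    (hasFDerivAt_frameTw_of_regPr F h hε₀ hα3 hα4 hexp U₀ hreg)).differentiableAt

end Background

/-! ## §2 `Q(U₀)` on the centre at a printed-regular background -/

section Assembly

variable (F : T3Family) {n K : ℕ} (h : n ≤ K)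

/-- ★★★ **`QTw U₀ (c·1) = QTw 1 (c·1)` ON PRINT'S REGULAR SPACE `𝔘_k(ε₀)`** (`RegPr F n K ε₀ U₀`, `10⁷L³ε₀ ≤ 1`): print's comb averaging operator `Q(U₀)` takes its FLAT value on the scalar sector —
for every complex bond field `c` (✓`QTw_smul_one_eq_QTw_one_of_imaginary` ∘ ✓`QTw_smulI_one_eq_QTw_one` with `hd`, `hd₁`, `hUZ`, `hUT`, `hδ` from §§2–3).
[cite: Balaban1985BackgroundPropagators, (3.14)-(3.15) p.393; Balaban1984PropagatorsI, (1.18) p.20; Balaban1985Averaging, (85)-(92) p.31; Balaban1985Variational, (2) p.278] -/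
theorem QTw_smul_one_eq_QTw_one_of_regPr {ε₀ : ℝ} (hε₀ : 0 < ε₀) (hε : 10 ^ 7 * (F.L : ℝ) ^ 3 * ε₀ ≤ 1)
    (U₀ : GaugeField (F.P K) 0 (Matrix.specialUnitaryGroup (Fin 2) ℂ)) (hreg : RegPr F n K ε₀ U₀) (c : PBond (F.P K) 0 → ℂ) :
    QTw F n K h U₀ (fun b => c b • (1 : Matrix (Fin 2) (Fin 2) ℂ)) = QTw F n K h 1 (fun b => c b • (1 : Matrix (Fin 2) (Fin 2) ℂ)) :=
  QTw_smul_one_eq_QTw_one_of_imaginary F h U₀ (fun r =>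
    QTw_smulI_one_eq_QTw_one F h U₀ r (differentiableAt_logChartTw_of_regPr F h hε₀ hε U₀ hreg) (differentiableAt_logChartTw_one F h)
      (loopsZ_bgUnits_le_eighth_of_regPr F hε₀ hε U₀ hreg) (loopHolU_emlIterU_bgUnits_le_eighth_of_regPr F hε₀ hε hreg) (scalarClauses_small F r)) c

/-- **APPLIED FORM**: `QTw U₀ (c·1) e = QTw 1 (c·1) e` at every coarse bond `e`. [cite: Balaban1985BackgroundPropagators, (3.14)-(3.15) p.393; Balaban1984PropagatorsI, (1.18) p.20] -/
theorem QTw_smul_one_apply_eq_QTw_one_of_regPr {ε₀ : ℝ} (hε₀ : 0 < ε₀) (hε : 10 ^ 7 * (F.L : ℝ) ^ 3 * ε₀ ≤ 1)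
    (U₀ : GaugeField (F.P K) 0 (Matrix.specialUnitaryGroup (Fin 2) ℂ)) (hreg : RegPr F n K ε₀ U₀) (c : PBond (F.P K) 0 → ℂ) (e : PBond (F.P n) 0) :
    QTw F n K h U₀ (fun b => c b • (1 : Matrix (Fin 2) (Fin 2) ℂ)) e = QTw F n K h 1 (fun b => c b • (1 : Matrix (Fin 2) (Fin 2) ℂ)) e := by
  rw [QTw_smul_one_eq_QTw_one_of_regPr F h hε₀ hε U₀ hreg c]

end Assembly

end Summit.QuantumFields.YangMills.Theorems.Prop7QTwCentralSectorRegPr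

end
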